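import Summits.QuantumAdvantage.QuantumAdvantage.Theses.LinnikCubicClassGroups
import Literature.NumberTheory.LFunctions.UniformClassGroupPNTGeneralDegree
import Literature.NumberTheory.LFunctions.UniformClassGroupPNTGeneralDegreeInputs
import Literature.NumberTheory.LFunctions.LogIntegralStrictMonoProofs
import Literature.NumberTheory.LFunctions.LogIntegralProofs
import Literature.NumberTheory.LFunctions.UniformClassGroupPNTTransfer
import Literature.NumberTheory.LFunctions.StarkExceptionalZero
import Literature.NumberTheory.LFunctions.PrimeIdealTheorem
import Literature.NumberTheory.LFunctions.PrimeIdealCountDegreeOne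
import Literature.NumberTheory.LFunctions.DedekindZetaRealZerosUniform
import Literature.RepresentationTheory.FiniteGroups.BrauerInduction

/-!
# Sketch — crux `DegreeOnePrimesEscape` (stmt-QuantumAdvantage-11543)
# ideas `one-sided-shadows` (§1) and `heilbronn-count-discharge` (§2)

First lemmas of the two lines, stated over existing declarations, AND (§3) a complete, sorry-free
CONDITIONAL PROOF of the crux from the two in-tree named facts:
`degreeOnePrimesEscape_of_TZ_Stark : ThornerZaman2019_classPNT_hilbertClassField →
Stark1974_dedekindZeta_ne_zero_of_noQuadraticSubfield → LinnikCubicClassGroups.DegreeOnePrimesEscape`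
(and `…_of_TZ_starkInexplicit` with the inexplicit Stark hypothesis of card 2).  The one `sorry`
left is the architecture-(B) composition `degreeOnePrimesEscape_of_deficits` (depth 1 only).
See `Ideas/*.md`.
-/

noncomputable section

open scoped NumberField nonZeroDivisors
open Literature.NumberTheory.LFunctions Literature.NumberTheory.LFunctions.NumberField

namespace Summit.QuantumAdvantage.QuantumAdvantage.Cruxes.DegreeOnePrimesEscape.OneSidedShadows

/-- **F_up (index-weighted one-sided subgroup bound; no hypothesis on `K`).** There is an
absolute `C₀` such that for every number field `K` of degree `> 1`, every `x ≥ Q^{C₀}`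
(`Q = |d_K| n_K^{n_K}`) and EVERY subgroup `M ≤ Cl(K)`:
`32 · [Cl(K):M] · #{𝔭 prime, N𝔭 ≤ x, [𝔭] ∈ M} ≤ 33 · Li(x)`.
Sign-immune: every real zero of every class-group `L`-function enters the count of primes in a
subgroup with a non-positive coefficient. -/
def SubgroupUpperShadow : Prop :=
  ∃ C₀ : ℝ, ∀ (K : Type) [Field K] [NumberField K], 1 < Module.finrank ℚ K →
    ∀ x : ℝ, ThornerZaman.condQn K ^ C₀ ≤ x →
    ∀ M : Subgroup (ClassGroup (𝓞 K)),
      32 * (M.index : ℝ) *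
          (Set.ncard {P : Ideal (𝓞 K) | P.IsPrime ∧ (Ideal.absNorm P : ℝ) ≤ x ∧
              ∃ hP : P ∈ (Ideal (𝓞 K))⁰, ClassGroup.mk0 ⟨P, hP⟩ ∈ M} : ℝ)
        ≤ 33 * offsetLogIntegral x

/-- **F_low (lower prime ideal theorem at polynomial height for fields without a quadratic
subfield).** For every `n > 1` there is `C₁ = C₁(n)` such that for every number field `K` of
degree `n` with no quadratic subfield and every `x ≥ Q^{C₁}`: `29 · Li(x) ≤ 32 · π_K(x)`. -/
def LowerPITShadow : Prop :=
  ∀ n : ℕ, 1 < n → ∃ C₁ : ℝ, ∀ (K : Type) [Field K] [NumberField K], Module.finrank ℚ K = n →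
    (∀ F : IntermediateField ℚ K, Module.finrank ℚ F ≠ 2) →
    ∀ x : ℝ, ThornerZaman.condQn K ^ C₁ ≤ x →
      29 * offsetLogIntegral x ≤ 32 * (primeIdealCount K x : ℝ)

/-- **The sign lemma (the lever in its purest form; PROVED).** For every character `χ` of a
finite abelian group and every subgroup `M`, `∑_{C ∈ M} Re χ(C) ≥ 0` (the sum is `|M|` if
`χ|_M = 1` and `0` otherwise, Mathlib `sum_hom_units_eq_zero`).  Applied to the exceptional real
class-group character `χ₁` of the Thorner–Zaman dichotomy, the `Li(x^{β₁})`-term of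
`∑_{C ∈ M} π_C(x)` carries the coefficient `-∑_{C∈M} χ₁(C)/h ≤ 0` and is DROPPED: the count of
primes in a subgroup never sees an exceptional zero from below. [folklore] -/
theorem sum_subgroup_char_re_nonneg {G : Type*} [CommGroup G] [Fintype G]
    (M : Subgroup G) [DecidablePred (· ∈ M)] (χ : G →* ℂˣ) :
    0 ≤ ∑ C ∈ Finset.univ.filter (· ∈ M), ((χ C : ℂ)).re := by
  classical
  set ψ : M →* ℂ := (Units.coeHom ℂ).comp (χ.comp M.subtype) with hψ
  have hsum : ∑ C ∈ Finset.univ.filter (· ∈ M), ((χ C : ℂ)).re = ∑ m : M, (ψ m).re := by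
    rw [Finset.sum_subtype (Finset.univ.filter (· ∈ M)) (p := (· ∈ M)) (by simp)]
    rfl
  rw [hsum, ← Complex.re_sum]
  by_cases h1 : ψ = 1
  · simp [h1]
  · rw [sum_hom_units_eq_zero ψ h1]
    simp

/-- `log Q ≥ n log 2` for `Q = |d_K| n^n`, `n = [K:ℚ] ≥ 2`. [folklore] -/
theorem finrank_mul_log_two_le_log_condQn (K : Type) [Field K] [NumberField K]
    (hK : 1 < Module.finrank ℚ K) :
    (Module.finrank ℚ K : ℝ) * Real.log 2 ≤ Real.log (ThornerZaman.condQn K) := by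
  have hn : (2 : ℝ) ≤ Module.finrank ℚ K := by exact_mod_cast hK
  have hd : (1 : ℝ) ≤ |(NumberField.discr K : ℝ)| := by
    rw [← Int.cast_abs]; exact_mod_cast Int.one_le_abs (NumberField.discr_ne_zero K)
  have hnpos : (0 : ℝ) < Module.finrank ℚ K := by linarith
  unfold ThornerZaman.condQn
  rw [Real.log_mul (by linarith) (by positivity), Real.log_pow]
  have h1 : 0 ≤ Real.log |(NumberField.discr K : ℝ)| := Real.log_nonneg hd
  have h2 : Real.log 2 ≤ Real.log (Module.finrank ℚ K : ℝ) := Real.log_le_log (by norm_num) hn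
  nlinarith

/-- The uniform error bound: with `L = max 1 (log (64 c₃))` and
`C₀ ≥ max (L/c₂) (L²/(c₂ log 2))`, for every `K` of degree `> 1` and `x ≥ Q^{C₀}`:
`c₃ · E(x) ≤ 1/32`. [folklore] -/
theorem errorTermN_le_of_ge {c₂ c₃ C₀ : ℝ} (hc₂ : 0 < c₂) (hc₃ : 0 < c₃)
    (hC₁ : max 1 (Real.log (64 * c₃)) / c₂ ≤ C₀)
    (hC₂ : (max 1 (Real.log (64 * c₃))) ^ 2 / (c₂ * Real.log 2) ≤ C₀)
    (K : Type) [Field K] [NumberField K] (hK : 1 < Module.finrank ℚ K)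
    {x : ℝ} (hx : ThornerZaman.condQn K ^ C₀ ≤ x) :
    c₃ * ThornerZaman.errorTermN c₂ (ThornerZaman.condQn K) (Module.finrank ℚ K) x ≤ 1 / 32 := by
  set L : ℝ := max 1 (Real.log (64 * c₃)) with hLdef
  set Q : ℝ := ThornerZaman.condQn K with hQdef
  set n : ℕ := Module.finrank ℚ K with hndef
  have hL1 : 1 ≤ L := le_max_left _ _
  have hL0 : 0 < L := by linarith
  have hQ12 : 12 ≤ Q := ThornerZaman.twelve_le_condQn (K := K) hK
  have hQpos : 0 < Q := by linarith
  have hlogQ : 0 < Real.log Q := Real.log_pos (by linarith)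
  have hC₀pos : 0 < C₀ := lt_of_lt_of_le (by positivity) hC₁
  have hxpos : 0 < x := lt_of_lt_of_le (Real.rpow_pos_of_pos hQpos _) hx
  have hlogx : C₀ * Real.log Q ≤ Real.log x := by
    have := Real.log_le_log (Real.rpow_pos_of_pos hQpos _) hx
    rwa [Real.log_rpow hQpos] at this
  have hlog2 : (0 : ℝ) < Real.log 2 := Real.log_pos (by norm_num)
  -- term 1
  have hT1 : Real.exp (-(c₂ * Real.log x / Real.log Q)) ≤ Real.exp (-L) := by
    apply Real.exp_le_exp.mpr
    have h1 : L ≤ c₂ * C₀ := by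
      have := (div_le_iff₀ hc₂).1 hC₁; linarith
    have h2 : c₂ * C₀ ≤ c₂ * Real.log x / Real.log Q := by
      rw [le_div_iff₀ hlogQ]; nlinarith
    linarith
  -- term 2
  have hnlog : (n : ℝ) * Real.log 2 ≤ Real.log Q := finrank_mul_log_two_le_log_condQn K hK
  have h2n : (2 : ℝ) ≤ n := by exact_mod_cast hK
  have hn0 : (0 : ℝ) < n := by linarith
  have hT2 : Real.exp (-(Real.sqrt (c₂ * Real.log x) / Real.sqrt n)) ≤ Real.exp (-L) := by
    apply Real.exp_le_exp.mpr
    have hsq : L ^ 2 ≤ c₂ * Real.log x / n := by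
      rw [le_div_iff₀ hn0]
      have h1 : L ^ 2 ≤ C₀ * (c₂ * Real.log 2) := by
        have := (div_le_iff₀ (by positivity)).1 hC₂; linarith
      have h2 : C₀ * (c₂ * Real.log 2) * n ≤ c₂ * (C₀ * Real.log Q) := by nlinarith
      nlinarith
    have hge : L ≤ Real.sqrt (c₂ * Real.log x) / Real.sqrt n := by
      rw [← Real.sqrt_div' _ hn0.le]  -- √a / √n = √(a/n)? check orientation
      calc L = Real.sqrt (L ^ 2) := by rw [Real.sqrt_sq hL0.le]
        _ ≤ Real.sqrt (c₂ * Real.log x / n) := Real.sqrt_le_sqrt hsq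
    linarith
  have hexpL : Real.exp (-L) ≤ 1 / (64 * c₃) := by
    have : Real.log (64 * c₃) ≤ L := le_max_right _ _
    calc Real.exp (-L) ≤ Real.exp (-Real.log (64 * c₃)) := Real.exp_le_exp.mpr (by linarith)
      _ = 1 / (64 * c₃) := by rw [Real.exp_neg, Real.exp_log (by positivity), one_div]
  unfold ThornerZaman.errorTermN
  have hsum : Real.exp (-(c₂ * Real.log x / Real.log Q)) +
      Real.exp (-(Real.sqrt (c₂ * Real.log x) / Real.sqrt n)) ≤ 2 * (1 / (64 * c₃)) := by linarith
  calc c₃ * (Real.exp (-(c₂ * Real.log x / Real.log Q)) +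
        Real.exp (-(Real.sqrt (c₂ * Real.log x) / Real.sqrt ↑n)))
      ≤ c₃ * (2 * (1 / (64 * c₃))) := by gcongr
    _ = 1 / 32 := by field_simp; ring

open Classical in
/-- **F_up in sum form, PROVED from the Thorner–Zaman named fact** (the card's depth 0): for an
absolute `C₀`, every `K` of degree `> 1`, `x ≥ Q^{C₀}` and subgroup `M ≤ Cl(K)`:
`32 · [Cl:M] · ∑_{C ∈ M} π_C(x) ≤ 33 · Li(x)`. -/
theorem subgroupClassSum_le_of_TZ (hTZ : ThornerZaman2019_classPNT_hilbertClassField) :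
    ∃ C₀ : ℝ, ∀ (K : Type) [Field K] [NumberField K], 1 < Module.finrank ℚ K →
      ∀ x : ℝ, ThornerZaman.condQn K ^ C₀ ≤ x →
      ∀ M : Subgroup (ClassGroup (𝓞 K)),
        32 * (M.index : ℝ) * ∑ C ∈ Finset.univ.filter (· ∈ M), (primeIdealClassCount K C x : ℝ)
          ≤ 33 * offsetLogIntegral x := by
  obtain ⟨c₁, c₂, c₃, hc₁, hc₂, hc₃, H⟩ := hTZ
  set L : ℝ := max 1 (Real.log (64 * c₃)) with hLdef
  refine ⟨max (max c₁ 1) (max (L / c₂) (L ^ 2 / (c₂ * Real.log 2))), ?_⟩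
  intro K _ _ hK x hx M
  set C₀ : ℝ := max (max c₁ 1) (max (L / c₂) (L ^ 2 / (c₂ * Real.log 2))) with hC₀def
  set Q : ℝ := ThornerZaman.condQn K with hQdef
  set h : ℕ := NumberField.classNumber K with hhdef
  have hQ12 : 12 ≤ Q := ThornerZaman.twelve_le_condQn (K := K) hK
  have hQ1 : 1 ≤ Q := by linarith
  have hC₀c₁ : c₁ ≤ C₀ := le_trans (le_max_left _ _) (le_max_left _ _)
  have hC₀1 : 1 ≤ C₀ := le_trans (le_max_right _ _) (le_max_left _ _)
  have hxc₁ : Q ^ c₁ ≤ x := le_trans (Real.rpow_le_rpow_of_exponent_le hQ1 hC₀c₁) hx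
  have hx12 : 12 ≤ x := by
    calc (12 : ℝ) ≤ Q := hQ12
      _ = Q ^ (1 : ℝ) := (Real.rpow_one Q).symm
      _ ≤ Q ^ C₀ := Real.rpow_le_rpow_of_exponent_le hQ1 hC₀1
      _ ≤ x := hx
  have hE : c₃ * ThornerZaman.errorTermN c₂ Q (Module.finrank ℚ K) x ≤ 1 / 32 :=
    errorTermN_le_of_ge hc₂ hc₃ (le_trans (le_max_left _ _) (le_max_right _ _))
      (le_trans (le_max_right _ _) (le_max_right _ _)) K hK hx
  have hEpos : 0 < c₃ * ThornerZaman.errorTermN c₂ Q (Module.finrank ℚ K) x :=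
    mul_pos hc₃ (ThornerZaman.errorTermN_pos _ _ _ _)
  -- Li(x) ≥ 0 and Li(x^β) ≥ 0 for β ≥ 1/2
  have hLimono := strictMonoOn_offsetLogIntegral_holds
  have hLi_nonneg : ∀ y : ℝ, 2 ≤ y → 0 ≤ offsetLogIntegral y := by
    intro y hy
    rcases eq_or_lt_of_le hy with h2 | h2
    · rw [← h2, offsetLogIntegral_two]
    · have := hLimono (show (2:ℝ) ∈ Set.Ioi 1 by norm_num) (show y ∈ Set.Ioi 1 from by
        simp only [Set.mem_Ioi]; linarith) h2
      rw [offsetLogIntegral_two] at this; exact this.le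
  have hLix : 0 ≤ offsetLogIntegral x := hLi_nonneg x (by linarith)
  -- index · |M| = h
  have hF : ((Finset.univ.filter (· ∈ M)).card : ℝ) * (M.index : ℝ) = h := by
    have h1 : (Finset.univ.filter (· ∈ M)).card = Nat.card M := by
      rw [Nat.card_eq_fintype_card, ← Fintype.card_subtype]
    have h2 : Nat.card M * M.index = Nat.card (ClassGroup (𝓞 K)) := Subgroup.card_mul_index M
    have h3 : Nat.card (ClassGroup (𝓞 K)) = h := by
      rw [hhdef, NumberField.classNumber, Nat.card_eq_fintype_card]
    rw [h1]
    exact_mod_cast h2.trans h3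
  have hhpos : (0 : ℝ) < h := by exact_mod_cast NumberField.classNumber_pos (K := K)
  -- a per-class bound `π_C ≤ (33/32) m_C` from `|π_C − m_C| ≤ c₃ E m_C`
  have key : ∀ (π m : ℝ), |π - m| ≤ c₃ * ThornerZaman.errorTermN c₂ Q (Module.finrank ℚ K) x * m →
      π ≤ 33 / 32 * m := by
    intro π m hπ
    have hm : 0 ≤ m := by
      by_contra hneg
      rw [not_le] at hneg
      have : c₃ * ThornerZaman.errorTermN c₂ Q (Module.finrank ℚ K) x * m < 0 := mul_neg_of_pos_of_neg hEpos hneg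
      linarith [abs_nonneg (π - m)]
    have h1 := (abs_sub_le_iff.1 hπ).1
    nlinarith
  rcases H K hK with ⟨-, hA⟩ | ⟨χ₁, β₁, -, hβlo, hβhi, -, hB⟩
  · -- no exceptional zero
    have hC : ∀ C : ClassGroup (𝓞 K),
        (primeIdealClassCount K C x : ℝ) ≤ 33 / 32 * (offsetLogIntegral x / h) :=
      fun C => key _ _ (hA C x hxc₁)
    calc 32 * (M.index : ℝ) * ∑ C ∈ Finset.univ.filter (· ∈ M), (primeIdealClassCount K C x : ℝ)
        ≤ 32 * (M.index : ℝ) * ∑ C ∈ Finset.univ.filter (· ∈ M), 33 / 32 * (offsetLogIntegral x / h) := by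
          gcongr with C hC'
          exact hC C
      _ = 33 * offsetLogIntegral x * (((Finset.univ.filter (· ∈ M)).card : ℝ) * (M.index : ℝ) / h) := by
          rw [Finset.sum_const, nsmul_eq_mul]; ring
      _ = 33 * offsetLogIntegral x := by rw [hF, div_self hhpos.ne', mul_one]
  · -- exceptional (χ₁, β₁)
    have hβhalf : (1:ℝ) / 2 ≤ β₁ := by
      have hlogQ : Real.log 12 ≤ Real.log Q := Real.log_le_log (by norm_num) hQ12
      have hlog12 : (1 : ℝ) < Real.log 12 := by
        have := Real.exp_one_lt_d9
        rw [Real.lt_log_iff_exp_lt (by norm_num)]; linarith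
      have hlogQpos : 0 < Real.log Q := by linarith
      have : 1 / (8 * Real.log Q) ≤ 1 / 8 := by
        rw [div_le_div_iff₀ (by positivity) (by norm_num)]; nlinarith
      linarith
    have hxβ : 2 ≤ x ^ β₁ := by
      have hx1 : (1:ℝ) ≤ x := by linarith
      calc (2 : ℝ) ≤ 12 ^ ((1:ℝ) / 2) := by
            rw [show (12:ℝ) = 2 ^ (2:ℝ) * 3 by norm_num, Real.mul_rpow (by positivity) (by norm_num),
              ← Real.rpow_mul (by norm_num)]
            norm_num
            have : (1:ℝ) ≤ (3:ℝ) ^ ((1:ℝ)/2) := Real.one_le_rpow (by norm_num) (by norm_num)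
            linarith
        _ ≤ x ^ ((1:ℝ) / 2) := Real.rpow_le_rpow (by norm_num) hx12 (by norm_num)
        _ ≤ x ^ β₁ := Real.rpow_le_rpow_of_exponent_le hx1 hβhalf
    have hLiβ : 0 ≤ offsetLogIntegral (x ^ β₁) := hLi_nonneg _ hxβ
    have hC : ∀ C : ClassGroup (𝓞 K), (primeIdealClassCount K C x : ℝ) ≤
        33 / 32 * ((offsetLogIntegral x - ((χ₁ C : ℂ)).re * offsetLogIntegral (x ^ β₁)) / h) :=
      fun C => key _ _ (hB C x hxc₁)
    have hsign : 0 ≤ ∑ C ∈ Finset.univ.filter (· ∈ M), ((χ₁ C : ℂ)).re :=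
      sum_subgroup_char_re_nonneg M χ₁
    set F := Finset.univ.filter (· ∈ M) with hFdef
    have hsum : ∑ C ∈ F, (offsetLogIntegral x - ((χ₁ C : ℂ)).re * offsetLogIntegral (x ^ β₁)) / (h : ℝ)
        = ((F.card : ℝ) * offsetLogIntegral x
            - (∑ C ∈ F, ((χ₁ C : ℂ)).re) * offsetLogIntegral (x ^ β₁)) / h := by
      rw [← Finset.sum_div, Finset.sum_sub_distrib, Finset.sum_const, nsmul_eq_mul, Finset.sum_mul]
    have hdrop : ((F.card : ℝ) * offsetLogIntegral x
            - (∑ C ∈ F, ((χ₁ C : ℂ)).re) * offsetLogIntegral (x ^ β₁)) / h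
          ≤ (F.card : ℝ) * offsetLogIntegral x / h := by
      apply div_le_div_of_nonneg_right _ hhpos.le
      nlinarith [mul_nonneg hsign hLiβ]
    calc 32 * (M.index : ℝ) * ∑ C ∈ F, (primeIdealClassCount K C x : ℝ)
        ≤ 32 * (M.index : ℝ) * ∑ C ∈ F,
            33 / 32 * ((offsetLogIntegral x - ((χ₁ C : ℂ)).re * offsetLogIntegral (x ^ β₁)) / h) := by
          gcongr with C hC'
          exact hC C
      _ = 32 * (M.index : ℝ) * (33 / 32 * (((F.card : ℝ) * offsetLogIntegral x
            - (∑ C ∈ F, ((χ₁ C : ℂ)).re) * offsetLogIntegral (x ^ β₁)) / h)) := by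
          rw [← Finset.mul_sum, hsum]
      _ ≤ 32 * (M.index : ℝ) * (33 / 32 * ((F.card : ℝ) * offsetLogIntegral x / h)) := by
          have hcoef : 0 ≤ 32 * (M.index : ℝ) := by positivity
          apply mul_le_mul_of_nonneg_left _ hcoef
          nlinarith [hdrop]
      _ = 33 * offsetLogIntegral x * ((F.card : ℝ) * (M.index : ℝ) / h) := by ring
      _ = 33 * offsetLogIntegral x := by rw [hF, div_self hhpos.ne', mul_one]

open Classical in
/-- The class map on ideals (junk value `1` at the zero ideal). [folklore] -/
noncomputable def classOf (K : Type) [Field K] [NumberField K] (P : Ideal (𝓞 K)) :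
    ClassGroup (𝓞 K) :=
  if hP : P ∈ (Ideal (𝓞 K))⁰ then ClassGroup.mk0 ⟨P, hP⟩ else 1

theorem classOf_eq {K : Type} [Field K] [NumberField K] {P : Ideal (𝓞 K)}
    (hP : P ∈ (Ideal (𝓞 K))⁰) : classOf K P = ClassGroup.mk0 ⟨P, hP⟩ := by
  rw [classOf, dif_pos hP]

open Classical in
/-- **Fibrewise count**: the primes of norm `≤ x` whose class lies in a finset `T` of classes are
counted class by class by the tree's `primeIdealClassCount`. [folklore] -/
theorem ncard_primes_class_mem_eq_sum (K : Type) [Field K] [NumberField K] (x : ℝ)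
    (T : Finset (ClassGroup (𝓞 K))) :
    Set.ncard {P : Ideal (𝓞 K) | P.IsPrime ∧ (Ideal.absNorm P : ℝ) ≤ x ∧
        ∃ hP : P ∈ (Ideal (𝓞 K))⁰, ClassGroup.mk0 ⟨P, hP⟩ ∈ T}
      = ∑ C ∈ T, primeIdealClassCount K C x := by
  set S : Set (Ideal (𝓞 K)) := {P : Ideal (𝓞 K) | P.IsPrime ∧ (Ideal.absNorm P : ℝ) ≤ x ∧
        ∃ hP : P ∈ (Ideal (𝓞 K))⁰, ClassGroup.mk0 ⟨P, hP⟩ ∈ T} with hSdef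
  have hSfin : S.Finite := by
    refine (finite_primeIdealsLE K x).subset ?_
    rintro P ⟨h1, h2, hP, -⟩
    exact ⟨h1, nonZeroDivisors.ne_zero hP, h2⟩
  rw [Set.ncard_eq_toFinset_card S hSfin]
  rw [Finset.card_eq_sum_card_fiberwise (f := classOf K) (t := T) ?_]
  · apply Finset.sum_congr rfl
    intro C hC
    rw [primeIdealClassCount, ← Set.ncard_coe_finset]
    congr 1
    ext P
    simp only [Finset.coe_filter, Set.Finite.mem_toFinset, Set.mem_setOf_eq, primeIdealsInClassLE,
      hSdef]
    constructor
    · rintro ⟨⟨h1, h2, hP, hT⟩, hc⟩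
      refine ⟨h1, h2, hP, ?_⟩
      rw [← classOf_eq hP]; exact hc
    · rintro ⟨h1, h2, hP, hc⟩
      refine ⟨⟨h1, h2, hP, ?_⟩, ?_⟩
      · rw [hc]; exact hC
      · rw [classOf_eq hP]; exact hc
  · intro P hPS
    rw [Finset.mem_coe, Set.Finite.mem_toFinset] at hPS
    obtain ⟨-, -, hP, hT⟩ := hPS
    rw [Finset.mem_coe, classOf_eq hP]; exact hT

/-- Depth 0 of the line: F_up is a two-line corollary of the in-tree Thorner–Zaman fact
(sum the class-by-class dichotomy over `C ∈ M`; `∑_{C ∈ M} χ₁(C) ∈ {0, |M|}` is `≥ 0`, so the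
`Li(x^{β₁})` term is dropped; the relative error `c₃ E(x) ≤ 1/32` once `x ≥ Q^{C₀}`). -/
theorem subgroupUpperShadow_of_TZ (hTZ : ThornerZaman2019_classPNT_hilbertClassField) :
    SubgroupUpperShadow := by
  classical
  obtain ⟨C₀, hC₀⟩ := subgroupClassSum_le_of_TZ hTZ
  refine ⟨C₀, fun K _ _ hK x hx M => ?_⟩
  have hset : {P : Ideal (𝓞 K) | P.IsPrime ∧ (Ideal.absNorm P : ℝ) ≤ x ∧
        ∃ hP : P ∈ (Ideal (𝓞 K))⁰, ClassGroup.mk0 ⟨P, hP⟩ ∈ M}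
      = {P : Ideal (𝓞 K) | P.IsPrime ∧ (Ideal.absNorm P : ℝ) ≤ x ∧
        ∃ hP : P ∈ (Ideal (𝓞 K))⁰, ClassGroup.mk0 ⟨P, hP⟩ ∈ Finset.univ.filter (· ∈ M)} := by
    ext P; simp
  have h := hC₀ K hK x hx M
  rw [hset, ncard_primes_class_mem_eq_sum K x (Finset.univ.filter (· ∈ M))]
  push_cast
  convert h using 2

/-- **An explicit upper bound for `Li`**: `Li(x) ≤ (26/25) · x/log x` once `log x ≥ 60`
(integration by parts `Li = x/log x − 2/log 2 + Li₂`, and `Li₂(x) ≤ Li₂(√x) + 2 Li(x)/log x`,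
`Li₂(√x) ≤ (√x − 2)/log² 2`, all from the tree's `LogIntegralProofs`). [folklore] -/
theorem offsetLogIntegral_le_mul_div_log {x : ℝ} (hx : Real.exp 60 ≤ x) :
    offsetLogIntegral x ≤ 26 / 25 * (x / Real.log x) := by
  have he : (1 : ℝ) ≤ Real.exp 60 := Real.one_le_exp (by norm_num)
  have hx1 : (1 : ℝ) < x := by
    have : (1:ℝ) < Real.exp 60 := by
      have := Real.add_one_le_exp (60:ℝ); linarith
    linarith
  have hx0 : 0 < x := by linarith
  have hlogx : 60 ≤ Real.log x := (Real.le_log_iff_exp_le hx0).2 hx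
  have hlogpos : 0 < Real.log x := by linarith
  -- √x
  have hsqrt_sq : Real.sqrt x ^ 2 = x := Real.sq_sqrt hx0.le
  have hsqrt1 : (1 : ℝ) < Real.sqrt x := by
    rw [show (1:ℝ) = Real.sqrt 1 by simp]; exact Real.sqrt_lt_sqrt (by norm_num) hx1
  have hlog_sqrt : Real.log (Real.sqrt x) = Real.log x / 2 := by
    rw [Real.log_sqrt hx0.le]
  -- e^{30} ≤ √x, hence 3000 · √x ≤ x / log x is not needed in this crude form; we use √x · 200 ≤ x/ log x
  have hsqrt_ge : Real.exp 30 ≤ Real.sqrt x := by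
    rw [show Real.exp 30 = Real.sqrt (Real.exp 60) by
      rw [show (60:ℝ) = 30 + 30 by norm_num, Real.exp_add, Real.sqrt_mul_self (Real.exp_pos _).le]]
    exact Real.sqrt_le_sqrt hx
  have h2sqrt : (2 : ℝ) ≤ Real.sqrt x := by
    have : (2:ℝ) ≤ Real.exp 30 := by have := Real.add_one_le_exp (30:ℝ); linarith
    linarith
  have hsqrt_le : Real.sqrt x ≤ x := by nlinarith
  -- (1) integration by parts
  have hparts := offsetLogIntegralPow_integration_by_parts 1 hx1
  rw [offsetLogIntegralPow_one] at hparts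
  simp only [pow_one, Nat.cast_one, one_mul] at hparts
  -- (2) Li₂ x ≤ Li₂ √x + (log √x)⁻¹ Li x
  have hsucc := offsetLogIntegralPow_succ_le 1 h2sqrt hsqrt_le
  rw [offsetLogIntegralPow_one, hlog_sqrt] at hsucc
  -- (3) Li₂ √x ≤ (log 2)⁻¹ Li₁ √x ≤ (log 2)⁻² (√x − 2)
  have hA := offsetLogIntegralPow_succ_le 1 (le_refl (2:ℝ)) h2sqrt
  have hB := offsetLogIntegralPow_succ_le 0 (le_refl (2:ℝ)) h2sqrt
  simp only [offsetLogIntegralPow_two, zero_add] at hA hB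
  rw [offsetLogIntegralPow_zero] at hB
  rw [offsetLogIntegralPow_one] at hA hB
  have hlog2 : (0.6931471803 : ℝ) < Real.log 2 := Real.log_two_gt_d9
  have hl2pos : 0 < Real.log 2 := by linarith
  have hinv2 : (Real.log 2)⁻¹ ≤ 3 / 2 := by
    rw [inv_le_comm₀ hl2pos (by norm_num)]; linarith
  have hLi_sqrt_nonneg : 0 ≤ offsetLogIntegral (Real.sqrt x) := by
    have := sub_mul_inv_log_pow_le_offsetLogIntegralPow 1 h2sqrt
    rw [offsetLogIntegralPow_one] at this
    have h0 : 0 ≤ (Real.sqrt x - 2) * (Real.log (Real.sqrt x))⁻¹ ^ 1 := by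
      apply mul_nonneg (by linarith)
      apply pow_nonneg; apply inv_nonneg.2; apply Real.log_nonneg hsqrt1.le
    linarith
  -- Li₂ √x ≤ (3/2) Li √x ≤ (3/2)(3/2)(√x − 2) ≤ (9/4) √x
  have hLi2sqrt : offsetLogIntegralPow 2 (Real.sqrt x) ≤ 9 / 4 * Real.sqrt x := by
    have h1 : offsetLogIntegralPow 2 (Real.sqrt x) ≤ 3 / 2 * offsetLogIntegral (Real.sqrt x) := by
      calc offsetLogIntegralPow 2 (Real.sqrt x) ≤ (Real.log 2)⁻¹ * offsetLogIntegral (Real.sqrt x) := hA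
        _ ≤ 3 / 2 * offsetLogIntegral (Real.sqrt x) := by gcongr
    have h2 : offsetLogIntegral (Real.sqrt x) ≤ 3 / 2 * (Real.sqrt x - 2) := by
      calc offsetLogIntegral (Real.sqrt x) ≤ (Real.log 2)⁻¹ * (Real.sqrt x - 2) := hB
        _ ≤ 3 / 2 * (Real.sqrt x - 2) := by gcongr
    nlinarith
  -- combine: Li x = x/log x − 2/log 2 + Li₂ x ≤ x/log x + 9/4 √x + (2/log x) Li x
  have hLi2x : offsetLogIntegralPow 2 x ≤ 9 / 4 * Real.sqrt x + (2 / Real.log x) * offsetLogIntegral x := by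
    have : (Real.log x / 2)⁻¹ = 2 / Real.log x := by rw [inv_div]
    rw [this] at hsucc
    linarith
  have hmain : offsetLogIntegral x * (1 - 2 / Real.log x) ≤ x / Real.log x + 9 / 4 * Real.sqrt x := by
    have h2l : 0 ≤ 2 * (Real.log 2)⁻¹ := by positivity
    have : offsetLogIntegral x ≤ x * (Real.log x)⁻¹ + offsetLogIntegralPow 2 x := by linarith
    rw [← div_eq_mul_inv] at this
    nlinarith
  -- 9/4 √x ≤ (1/1000) x / log x, via u = x^{1/4} ≥ e^{15} ≥ 9000 and log x ≤ 4u
  have hsmall : 9 / 4 * Real.sqrt x ≤ 1 / 1000 * (x / Real.log x) := by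
    have hsx0 : 0 ≤ Real.sqrt x := by linarith
    set u : ℝ := (Real.sqrt x) ^ ((1:ℝ)/2) with hu
    have hu2 : u * u = Real.sqrt x := by
      rw [hu, ← Real.rpow_add (by linarith)]; norm_num
    have hu_ge : Real.exp 15 ≤ u := by
      have : Real.exp 15 = (Real.exp 30) ^ ((1:ℝ)/2) := by
        rw [← Real.exp_mul]; norm_num
      rw [this, hu]
      exact Real.rpow_le_rpow (Real.exp_pos _).le hsqrt_ge (by norm_num)
    have he15 : (9000 : ℝ) ≤ Real.exp 15 := by
      have h1 : Real.exp 15 = Real.exp 1 ^ 15 := by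
        rw [← Real.exp_nat_mul]; norm_num
      have h2 : (2.7 : ℝ) ≤ Real.exp 1 := le_of_lt (lt_trans (by norm_num) Real.exp_one_gt_d9)
      rw [h1]
      calc (9000 : ℝ) ≤ 2.7 ^ 15 := by norm_num
        _ ≤ Real.exp 1 ^ 15 := pow_le_pow_left₀ (by norm_num) h2 15
    have hu9000 : (9000 : ℝ) ≤ u := le_trans he15 hu_ge
    have hupos : 0 < u := by linarith
    have hl : Real.log (Real.sqrt x) ≤ (Real.sqrt x) ^ ((1:ℝ)/2) / ((1:ℝ)/2) :=
      Real.log_le_rpow_div hsx0 (by norm_num)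
    have hlogx_le : Real.log x ≤ 4 * u := by
      have h1 : Real.log x = 2 * Real.log (Real.sqrt x) := by rw [hlog_sqrt]; ring
      have h2 : Real.log (Real.sqrt x) ≤ 2 * u := by
        calc Real.log (Real.sqrt x) ≤ u / ((1:ℝ)/2) := hl
          _ = 2 * u := by ring
      linarith
    have hx_u : x = (u * u) * (u * u) := by
      calc x = Real.sqrt x ^ 2 := hsqrt_sq.symm
        _ = (u * u) * (u * u) := by rw [← hu2]; ring
    have hdiv : x / (4 * u) ≤ x / Real.log x :=
      div_le_div_of_nonneg_left hx0.le hlogpos hlogx_le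
    have hkey : 9 / 4 * Real.sqrt x ≤ 1 / 1000 * (x / (4 * u)) := by
      rw [← hu2, hx_u]
      have : 1 / 1000 * ((u * u) * (u * u) / (4 * u)) = u ^ 3 / 4000 := by
        field_simp; ring
      rw [this]
      nlinarith [hu9000, hupos]
    calc 9 / 4 * Real.sqrt x ≤ 1 / 1000 * (x / (4 * u)) := hkey
      _ ≤ 1 / 1000 * (x / Real.log x) := by gcongr
  -- finish: Li x (1 − 2/log x) ≤ (1 + 1/1000) x/log x and 1 − 2/log x ≥ 29/30
  have hfac : (29:ℝ)/30 ≤ 1 - 2 / Real.log x := by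
    have : 2 / Real.log x ≤ 1 / 30 := by
      rw [div_le_iff₀ hlogpos]; linarith
    linarith
  have hxl : 0 ≤ x / Real.log x := by positivity
  by_cases hLi : offsetLogIntegral x ≤ 0
  · linarith
  · rw [not_le] at hLi
    have h1 : offsetLogIntegral x * (29 / 30) ≤ 1001 / 1000 * (x / Real.log x) := by
      calc offsetLogIntegral x * (29 / 30) ≤ offsetLogIntegral x * (1 - 2 / Real.log x) := by
            gcongr
        _ ≤ x / Real.log x + 9 / 4 * Real.sqrt x := hmain
        _ ≤ 1001 / 1000 * (x / Real.log x) := by linarith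
    linarith

open Classical in
/-- `π_K(x) = ∑_C π_C(x)`. [folklore] -/
theorem primeIdealCount_eq_sum_classCount (K : Type) [Field K] [NumberField K] (x : ℝ) :
    primeIdealCount K x = ∑ C : ClassGroup (𝓞 K), primeIdealClassCount K C x := by
  rw [← ncard_primes_class_mem_eq_sum K x Finset.univ, primeIdealCount]
  congr 1
  ext P
  simp only [primeIdealsLE, Set.mem_setOf_eq, Finset.mem_univ, exists_prop, and_true]
  constructor
  · rintro ⟨h1, h2, h3⟩
    exact ⟨h1, h3, mem_nonZeroDivisors_of_ne_zero h2⟩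
  · rintro ⟨h1, h2, h3⟩
    exact ⟨h1, nonZeroDivisors.ne_zero h3, h2⟩

/-- Degree-one primes of `K` of norm `≤ x` in the class `C`. [folklore] -/
def degOneClassCount (K : Type) [Field K] [NumberField K] (C : ClassGroup (𝓞 K)) (x : ℝ) : ℕ :=
  Set.ncard {P : Ideal (𝓞 K) | (Ideal.absNorm P).Prime ∧ (Ideal.absNorm P : ℝ) ≤ x ∧
    ∃ hP : P ∈ (Ideal (𝓞 K))⁰, ClassGroup.mk0 ⟨P, hP⟩ = C}

/-- **D_χ (per-character one-sided deficit; no hypothesis on `K`; depth-1 replacement of F_up).**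
For every `n > 1` there is `C₂ = C₂(n)` such that for every number field `K` of degree `n`, every
NONTRIVIAL class-group character `χ` and every `x ≥ Q^{C₂}`:
`8 · Re ∑_{N𝔭 prime ≤ x} χ([𝔭]) ≤ Li(x)`.  Because
`#{deg-1 𝔭 ∉ M} = (1 − 1/m) π_K^{(1)} − (1/m) ∑_{χ ⊥ M, χ ≠ 1} Re S_χ` (`m = [Cl:M]`) is an AVERAGE
over the `m − 1` nontrivial characters of `Cl/M`, per-character bounds lose nothing in `m`: the
crux needs zero density ONE `L`-function at a time (no large sieve over the family). -/
def PerCharacterDeficit : Prop :=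
  ∀ n : ℕ, 1 < n → ∃ C₂ : ℝ, ∀ (K : Type) [Field K] [NumberField K], Module.finrank ℚ K = n →
    ∀ χ : ClassGroup (𝓞 K) →* ℂˣ, χ ≠ 1 →
    ∀ x : ℝ, ThornerZaman.condQn K ^ C₂ ≤ x →
      8 * ∑ C : ClassGroup (𝓞 K), ((χ C : ℂ)).re * (degOneClassCount K C x : ℝ) ≤ offsetLogIntegral x

/-- Composition, architecture (B): orthogonality of the characters of the finite abelian group
`Cl(K)/M` and the two shadows D_χ, F_low give the crux with the same constants
(`(1 − 1/m)(29/32 − 1/8) ≥ 25/64`, `8 · 25/64 = 25/8 > 2 log 4`). -/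
theorem degreeOnePrimesEscape_of_deficits (hD : PerCharacterDeficit) (hlow : LowerPITShadow) :
    Summit.QuantumAdvantage.QuantumAdvantage.Theses.LinnikCubicClassGroups.DegreeOnePrimesEscape := by
  sorry

/-! ### Counting helpers for the composition -/

open Classical in
/-- **Degree-one primes, counted by norm**: the nonzero primes of prime norm `≤ x` number
`∑_{p ≤ x} #{𝔭 : N𝔭 = p}` (the tree's `normPrimeIdealCount`). [folklore] -/
theorem ncard_degOne_eq_sum (K : Type) [Field K] [NumberField K] (x : ℕ) :
    Set.ncard {P : Ideal (𝓞 K) | P.IsPrime ∧ P ≠ ⊥ ∧ (Ideal.absNorm P).Prime ∧ Ideal.absNorm P ≤ x}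
      = ∑ p ∈ (Finset.Icc 0 x).filter Nat.Prime, normPrimeIdealCount K p := by
  set S : Set (Ideal (𝓞 K)) :=
    {P : Ideal (𝓞 K) | P.IsPrime ∧ P ≠ ⊥ ∧ (Ideal.absNorm P).Prime ∧ Ideal.absNorm P ≤ x} with hSdef
  have hSfin : S.Finite := by
    refine (Ideal.finite_setOf_absNorm_le (S := 𝓞 K) x).subset ?_
    rintro P ⟨-, -, -, h4⟩
    exact h4
  rw [Set.ncard_eq_toFinset_card S hSfin]
  rw [Finset.card_eq_sum_card_fiberwise (f := fun P : Ideal (𝓞 K) => Ideal.absNorm P)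
    (t := (Finset.Icc 0 x).filter Nat.Prime) ?_]
  · apply Finset.sum_congr rfl
    intro p hp
    rw [Finset.mem_filter] at hp
    rw [normPrimeIdealCount, ← Set.ncard_coe_finset]
    congr 1
    ext P
    simp only [Finset.coe_filter, Set.Finite.mem_toFinset, Set.mem_setOf_eq, hSdef]
    constructor
    · rintro ⟨⟨h1, h2, -, -⟩, h5⟩
      exact ⟨h1, h2, h5⟩
    · rintro ⟨h1, h2, h5⟩
      refine ⟨⟨h1, h2, ?_, ?_⟩, h5⟩
      · rw [h5]; exact hp.2
      · rw [h5]; exact (Finset.mem_Icc.1 hp.1).2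
  · intro P hPS
    rw [Finset.mem_coe, Set.Finite.mem_toFinset] at hPS
    obtain ⟨-, -, h3, h4⟩ := hPS
    rw [Finset.mem_coe, Finset.mem_filter, Finset.mem_Icc]
    exact ⟨⟨Nat.zero_le _, h4⟩, h3⟩

open Classical in
/-- `π_K(x) ≤ #{degree-one primes ≤ x} + [K:ℚ]·π(√x)` (tree lemmas
`primeIdealCount_eq_sum_normPrimeIdealCount`, `sum_normPrimeIdealCount_not_prime_le`). [folklore] -/
theorem primeIdealCount_le_degOne_add (K : Type) [Field K] [NumberField K] (x : ℕ) :
    primeIdealCount K x ≤ ∑ p ∈ (Finset.Icc 0 x).filter Nat.Prime, normPrimeIdealCount K p +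
      Module.finrank ℚ K * Nat.primeCounting (Nat.sqrt x) := by
  have hx : (0 : ℝ) ≤ x := Nat.cast_nonneg x
  rw [primeIdealCount_eq_sum_normPrimeIdealCount K hx, Nat.floor_natCast,
    ← Finset.sum_filter_add_sum_filter_not (Finset.Icc 0 x) Nat.Prime]
  exact Nat.add_le_add_left (sum_normPrimeIdealCount_not_prime_le K x) _

/-- Numerical size lemma: for `x ≥ (100(n+1))⁴`,
`(8n+2)√x + 8n + 7 ≤ (7/20) · x/log x` (via `t = x^{1/4}`, `log x ≤ 4t`). [folklore] -/
theorem size_ineq (n : ℕ) {x : ℝ} (hx : ((100 * ((n : ℝ) + 1)) ^ 4) ≤ x) :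
    8 * ((n : ℝ) * Real.sqrt x) + 2 * Real.sqrt x + 8 * n + 7 ≤ 7 / 20 * (x / Real.log x) := by
  have hn0 : (0 : ℝ) ≤ n := Nat.cast_nonneg n
  have h100 : (100 : ℝ) ≤ 100 * ((n : ℝ) + 1) := by nlinarith
  have hx1e8 : (100 : ℝ) ^ 4 ≤ x := le_trans (pow_le_pow_left₀ (by norm_num) h100 4) hx
  have hxpos : 0 < x := by linarith [show (0:ℝ) < 100 ^ 4 by norm_num]
  have hx1 : 1 < x := by linarith [show (1:ℝ) < 100 ^ 4 by norm_num]
  set t : ℝ := x ^ ((1:ℝ)/4) with ht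
  have htpos : 0 < t := Real.rpow_pos_of_pos hxpos _
  have ht4 : t ^ 4 = x := by
    rw [ht, ← Real.rpow_natCast, ← Real.rpow_mul hxpos.le]; norm_num
  have ht2 : t ^ 2 = Real.sqrt x := by
    rw [ht, ← Real.rpow_natCast, ← Real.rpow_mul hxpos.le, Real.sqrt_eq_rpow]; norm_num
  have htge : 100 * ((n : ℝ) + 1) ≤ t := by
    have : (100 * ((n : ℝ) + 1)) = ((100 * ((n : ℝ) + 1)) ^ 4) ^ ((1:ℝ)/4) := by
      rw [← Real.rpow_natCast, ← Real.rpow_mul (by positivity)]; norm_num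
    rw [this, ht]
    exact Real.rpow_le_rpow (by positivity) hx (by norm_num)
  have hlog : Real.log x ≤ 4 * t := by
    have := Real.log_le_rpow_div hxpos.le (show (0:ℝ) < 1/4 by norm_num)
    rw [← ht] at this
    linarith
  have hlogpos : 0 < Real.log x := Real.log_pos hx1
  -- x / log x ≥ t^4 / (4t) = t^3/4
  have hquot : t ^ 3 / 4 ≤ x / Real.log x := by
    rw [div_le_div_iff₀ (by norm_num) hlogpos]
    calc t ^ 3 * Real.log x ≤ t ^ 3 * (4 * t) :=
          mul_le_mul_of_nonneg_left hlog (pow_pos htpos 3).le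
      _ = x * 4 := by rw [← ht4]; ring
  rw [← ht2]
  nlinarith [htge, hquot, pow_pos htpos 2, sq_nonneg t, hn0, mul_pos htpos htpos]

/-- `(100(n+1))⁴ ≤ 3^C` once `C ≥ 50(1+n²)`. [folklore] -/
theorem pow_bound (n C : ℕ) (hC : 50 * (1 + n ^ 2) ≤ C) : (100 * (n + 1)) ^ 4 ≤ 3 ^ C := by
  have h1 : n + 1 ≤ 3 ^ n := by
    have := Nat.lt_pow_self (show 1 < 3 by norm_num) (n := n)
    omega
  have h2 : 100 * (n + 1) ≤ 3 ^ (5 + n) := by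
    rw [pow_add]; nlinarith [show (100:ℕ) ≤ 3 ^ 5 by norm_num]
  calc (100 * (n + 1)) ^ 4 ≤ (3 ^ (5 + n)) ^ 4 := Nat.pow_le_pow_left h2 4
    _ = 3 ^ (20 + 4 * n) := by rw [← pow_mul]; ring_nf
    _ ≤ 3 ^ C := Nat.pow_le_pow_right (by norm_num) (by nlinarith)

/-- The composition (pure counting): outside `M` = (degree-one primes) − (degree-one primes in
`M`) ≥ (29/32)Li − n·π(√x) − (33/64)Li ≥ (25/64)Li − n√x since `[Cl:M] ≥ 2`, and
`π(x) ≤ 2 log 4 · x/log x + √x ≤ (25/8)·(x − 2)/log x − 8n√x ≤ 8 · outside` for `x ≥ Q^C`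
(Mathlib `Chebyshev.pi_le_log4_mul_div`; tree `primeIdealCount_le_sum_idealNormCount_add`,
`sub_mul_inv_log_pow_le_offsetLogIntegralPow`). -/
theorem degreeOnePrimesEscape_of_shadows (hup : SubgroupUpperShadow) (hlow : LowerPITShadow) :
    Summit.QuantumAdvantage.QuantumAdvantage.Theses.LinnikCubicClassGroups.DegreeOnePrimesEscape := by
  classical
  intro n
  rcases Nat.lt_or_ge n 3 with hn3 | hn3
  · -- degenerate degrees n ≤ 2: the hypotheses are contradictory
    refine ⟨0, ?_⟩
    intro K _ _ hKn hnq x hx M hM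
    exfalso
    interval_cases n
    · exact (Module.finrank_pos (R := ℚ) (M := K)).ne' hKn
    · -- degree one: `𝓞 K ≃ ℤ`, the class group is trivial, so `M = ⊤`
      apply hM
      have hbij : Function.Bijective (algebraMap ℚ K) :=
        Algebra.finrank_eq_one_iff_bijective_algebraMap.mp hKn
      have : IsIntegralClosure ℤ ℤ K :=
        .of_algEquiv _ (.ofBijective (IsScalarTower.toAlgHom ℤ ℚ K) hbij) (by simp)
      have e : ℤ ≃ₐ[ℤ] 𝓞 K := IsIntegralClosure.equiv ℤ ℤ K (𝓞 K)
      have hPID : IsPrincipalIdealRing (𝓞 K) :=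
        IsPrincipalIdealRing.of_surjective (e : ℤ →+* 𝓞 K) e.surjective
      have h1 : NumberField.classNumber K = 1 := (NumberField.classNumber_eq_one_iff).mpr hPID
      have hsub : Subsingleton (ClassGroup (𝓞 K)) := by
        rw [NumberField.classNumber] at h1
        exact Fintype.card_le_one_iff_subsingleton.mp h1.le
      rw [Subgroup.eq_top_iff']
      intro g
      rw [Subsingleton.elim g 1]
      exact M.one_mem
    · -- degree two: `K` itself is a quadratic subfield
      exact hnq ⊤ (by rw [IntermediateField.finrank_top', hKn])
  · -- the main case n ≥ 3
    have h1n : 1 < n := by omega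
    obtain ⟨C₀, hC₀⟩ := hup
    obtain ⟨C₁, hC₁⟩ := hlow n h1n
    set C' : ℝ := max (max C₀ C₁) 1 with hC'def
    refine ⟨(⌈C'⌉₊ + 50) * (1 + n ^ 2) + n, ?_⟩
    intro K _ _ hKn hnq x hx M hM
    have hK : 1 < Module.finrank ℚ K := by rw [hKn]; exact h1n
    set Cn : ℕ := (⌈C'⌉₊ + 50) * (1 + n ^ 2) + n with hCndef
    set xr : ℝ := (x : ℝ) with hxrdef
    set d : ℝ := |(NumberField.discr K : ℝ)| with hddef
    set Q : ℝ := ThornerZaman.condQn K with hQdef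
    -- d ≥ 3, Q = d n^n ≤ d^(1+n²)
    have hd3 : (3:ℝ) ≤ d := by
      have h2 := NumberField.abs_discr_gt_two hK
      rw [hddef, ← Int.cast_abs]
      exact_mod_cast (show (3:ℤ) ≤ |NumberField.discr K| by omega)
    have hd1 : (1:ℝ) ≤ d := by linarith
    have hQ : Q = d * (n : ℝ) ^ n := by rw [hQdef, ThornerZaman.condQn, hKn]
    have hnn : (n : ℝ) ^ n ≤ d ^ (n ^ 2) := by
      have h1 : (n : ℝ) ≤ 3 ^ n := by
        exact_mod_cast (Nat.lt_pow_self (by norm_num : 1 < 3) (n := n)).le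
      calc (n:ℝ) ^ n ≤ (3 ^ n) ^ n := pow_le_pow_left₀ (by positivity) h1 n
        _ = 3 ^ (n ^ 2) := by rw [← pow_mul]; ring_nf
        _ ≤ d ^ (n ^ 2) := pow_le_pow_left₀ (by norm_num) hd3 _
    have hQle : Q ≤ d ^ (1 + n ^ 2) := by
      rw [hQ, pow_add, pow_one]
      exact mul_le_mul_of_nonneg_left hnn (by linarith)
    have hQ12 : 12 ≤ Q := ThornerZaman.twelve_le_condQn (K := K) hK
    have hQ1 : 1 ≤ Q := by linarith
    -- x ≥ d^Cn ≥ 3^Cn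
    have hx_d : d ^ Cn ≤ xr := by
      have h1 : ((|NumberField.discr K| ^ Cn : ℤ) : ℝ) ≤ ((x : ℤ) : ℝ) := by exact_mod_cast hx
      rw [Int.cast_pow, Int.cast_abs, Int.cast_natCast] at h1
      exact h1
    have hx_3 : (3:ℝ) ^ Cn ≤ xr := le_trans (pow_le_pow_left₀ (by norm_num) hd3 Cn) hx_d
    -- Q^{C'} ≤ xr
    have hQC' : Q ^ C' ≤ xr := by
      have h1 : Q ^ C' ≤ Q ^ ((⌈C'⌉₊ + 50 : ℕ) : ℝ) := by
        apply Real.rpow_le_rpow_of_exponent_le hQ1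
        have := Nat.le_ceil C'
        push_cast
        linarith
      rw [Real.rpow_natCast] at h1
      calc Q ^ C' ≤ Q ^ (⌈C'⌉₊ + 50) := h1
        _ ≤ (d ^ (1 + n ^ 2)) ^ (⌈C'⌉₊ + 50) := pow_le_pow_left₀ (by linarith) hQle _
        _ = d ^ ((1 + n ^ 2) * (⌈C'⌉₊ + 50)) := by rw [← pow_mul]
        _ ≤ d ^ Cn := pow_le_pow_right₀ hd1 (by rw [hCndef]; nlinarith)
        _ ≤ xr := hx_d
    have hC₀le : C₀ ≤ C' := le_trans (le_max_left _ _) (le_max_left _ _)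
    have hC₁le : C₁ ≤ C' := le_trans (le_max_right _ _) (le_max_left _ _)
    have hQC₀ : Q ^ C₀ ≤ xr := le_trans (Real.rpow_le_rpow_of_exponent_le hQ1 hC₀le) hQC'
    have hQC₁ : Q ^ C₁ ≤ xr := le_trans (Real.rpow_le_rpow_of_exponent_le hQ1 hC₁le) hQC'
    have hupK := hC₀ K hK xr hQC₀ M
    have hlowK := hC₁ K hKn hnq xr hQC₁
    -- sizes
    have hCn50 : 50 * (1 + n ^ 2) ≤ Cn := by rw [hCndef]; nlinarith
    have hxbig : (100 * ((n:ℝ) + 1)) ^ 4 ≤ xr := by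
      have h1 : ((100 * (n + 1)) ^ 4 : ℕ) ≤ 3 ^ Cn := pow_bound n Cn hCn50
      have h2 : (((100 * (n + 1)) ^ 4 : ℕ) : ℝ) ≤ ((3 ^ Cn : ℕ) : ℝ) := by exact_mod_cast h1
      push_cast at h2
      linarith
    have hsize := size_ineq n hxbig
    have hx3' : (3:ℝ) ≤ xr := by
      have : (3:ℝ) ^ 1 ≤ 3 ^ Cn := pow_le_pow_right₀ (by norm_num) (by omega)
      linarith
    have hxpos : 0 < xr := by linarith
    have hx1 : 1 < xr := by linarith
    have hx2 : 2 ≤ xr := by linarith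
    have hlogx : 1 ≤ Real.log xr := by
      rw [Real.le_log_iff_exp_le hxpos]
      have := Real.exp_one_lt_d9
      linarith
    have hlogpos : 0 < Real.log xr := by linarith
    -- Li ≥ (x-2)/log x ≥ x/log x − 2
    have hLi : xr / Real.log xr - 2 ≤ offsetLogIntegral xr := by
      have h1 := sub_mul_inv_log_pow_le_offsetLogIntegralPow 1 hx2
      rw [offsetLogIntegralPow_one, pow_one, ← div_eq_mul_inv] at h1
      have h2 : xr / Real.log xr - 2 ≤ (xr - 2) / Real.log xr := by
        rw [sub_div]
        have : 2 / Real.log xr ≤ 2 := by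
          rw [div_le_iff₀ hlogpos]; nlinarith
        linarith
      linarith
    -- π(x) ≤ 2 log 4 · x/log x + √x
    have hA0 : 0 ≤ xr / Real.log xr := by positivity
    have hpi : (Nat.primeCounting x : ℝ) ≤ 2.7726 * (xr / Real.log xr) + Real.sqrt xr := by
      have h1 := Chebyshev.pi_le_log4_mul_div hx1
      rw [hxrdef, Nat.floor_natCast] at h1
      have hlogsqrt : Real.log (Real.sqrt (x:ℝ)) = Real.log (x:ℝ) / 2 := Real.log_sqrt (by positivity)
      rw [hlogsqrt] at h1
      have e3 : Real.log 4 * (x:ℝ) / (Real.log (x:ℝ) / 2) = 2 * Real.log 4 * ((x:ℝ) / Real.log (x:ℝ)) := by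
        field_simp
      rw [e3] at h1
      have hlog4 : Real.log 4 < 1.3863 := by
        have : Real.log 4 = 2 * Real.log 2 := by
          rw [show (4:ℝ) = 2 ^ 2 by norm_num, Real.log_pow]; norm_num
        rw [this]; have := Real.log_two_lt_d9; linarith
      have h4 : 2 * Real.log 4 * (xr / Real.log xr) ≤ 2.7726 * (xr / Real.log xr) :=
        mul_le_mul_of_nonneg_right (by linarith) hA0
      rw [hxrdef] at h4 ⊢
      linarith
    -- counting
    set Sout : Set (Ideal (𝓞 K)) := {P : Ideal (𝓞 K) | P.IsPrime ∧ (Ideal.absNorm P).Prime ∧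
        Ideal.absNorm P ≤ x ∧ ∃ hP : P ∈ nonZeroDivisors (Ideal (𝓞 K)), ClassGroup.mk0 ⟨P, hP⟩ ∉ M}
      with hSout
    set Sin : Set (Ideal (𝓞 K)) := {P : Ideal (𝓞 K) | P.IsPrime ∧ (Ideal.absNorm P : ℝ) ≤ xr ∧
        ∃ hP : P ∈ (Ideal (𝓞 K))⁰, ClassGroup.mk0 ⟨P, hP⟩ ∈ M} with hSin
    set D : Set (Ideal (𝓞 K)) := {P : Ideal (𝓞 K) | P.IsPrime ∧ P ≠ ⊥ ∧ (Ideal.absNorm P).Prime ∧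
        Ideal.absNorm P ≤ x} with hD
    have hfin : (Sout ∪ Sin).Finite := by
      refine (Ideal.finite_setOf_absNorm_le (S := 𝓞 K) x).subset ?_
      rintro P (⟨-, -, h3, -⟩ | ⟨-, h2, -⟩)
      · exact h3
      · show Ideal.absNorm P ≤ x
        have h2' : (Ideal.absNorm P : ℝ) ≤ (x : ℝ) := h2
        exact_mod_cast h2'
    have hcover : D ⊆ Sout ∪ Sin := by
      rintro P ⟨h1, h2, h3, h4⟩
      have hP : P ∈ (Ideal (𝓞 K))⁰ := mem_nonZeroDivisors_of_ne_zero h2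
      by_cases hc : ClassGroup.mk0 ⟨P, hP⟩ ∈ M
      · right
        refine ⟨h1, ?_, hP, hc⟩
        show (Ideal.absNorm P : ℝ) ≤ (x : ℝ)
        exact_mod_cast h4
      · left; exact ⟨h1, h3, h4, hP, hc⟩
    have hcount : Set.ncard D ≤ Set.ncard Sout + Set.ncard Sin :=
      le_trans (Set.ncard_le_ncard hcover hfin) (Set.ncard_union_le _ _)
    have hDeq : Set.ncard D = ∑ p ∈ (Finset.Icc 0 x).filter Nat.Prime, normPrimeIdealCount K p :=
      ncard_degOne_eq_sum K x
    have hdeg := primeIdealCount_le_degOne_add K x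
    rw [hKn, ← hDeq] at hdeg
    -- π(√x) ≤ √x + 1
    have hpisqrt : (Nat.primeCounting (Nat.sqrt x) : ℝ) ≤ Real.sqrt xr + 1 := by
      have h1 : Nat.primeCounting (Nat.sqrt x) ≤ Nat.sqrt x + 1 := by
        rw [Nat.primeCounting, Nat.primeCounting']
        exact Nat.count_le _
      have h2 : ((Nat.sqrt x : ℕ) : ℝ) ≤ Real.sqrt xr := by
        rw [hxrdef, Real.le_sqrt (by positivity) (by positivity)]
        exact_mod_cast Nat.sqrt_le' x
      calc (Nat.primeCounting (Nat.sqrt x) : ℝ) ≤ (Nat.sqrt x : ℝ) + 1 := by exact_mod_cast h1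
        _ ≤ Real.sqrt xr + 1 := by linarith
    -- index ≥ 2
    have hidx : (2 : ℝ) ≤ M.index := by
      have h1 : M.index ≠ 1 := fun h => hM (Subgroup.index_eq_one.mp h)
      have h2 : M.index ≠ 0 := Subgroup.index_ne_zero_of_finite
      exact_mod_cast (show 2 ≤ M.index by omega)
    have hin0 : (0:ℝ) ≤ Set.ncard Sin := Nat.cast_nonneg _
    have hup' : 64 * (Set.ncard Sin : ℝ) ≤ 33 * offsetLogIntegral xr := by
      have : 32 * 2 * (Set.ncard Sin : ℝ) ≤ 32 * (M.index : ℝ) * (Set.ncard Sin : ℝ) := by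
        apply mul_le_mul_of_nonneg_right _ hin0
        linarith
      linarith
    -- assembly in ℝ
    have e1 : ((primeIdealCount K xr : ℕ) : ℝ) ≤
        (Set.ncard D : ℝ) + (n : ℝ) * Real.sqrt xr + n := by
      have h1 : ((primeIdealCount K (x:ℝ) : ℕ) : ℝ) ≤
          ((Set.ncard D + n * Nat.primeCounting (Nat.sqrt x) : ℕ) : ℝ) := by
        exact_mod_cast hdeg
      push_cast at h1
      have hn0 : (0:ℝ) ≤ n := Nat.cast_nonneg n
      have h2 : (n:ℝ) * (Nat.primeCounting (Nat.sqrt x) : ℝ) ≤ n * (Real.sqrt xr + 1) :=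
        mul_le_mul_of_nonneg_left hpisqrt hn0
      have h3 : (n:ℝ) * (Real.sqrt xr + 1) = n * Real.sqrt xr + n := by ring
      rw [h3] at h2
      rw [hxrdef] at h2 ⊢
      linarith
    have e2 : (Set.ncard D : ℝ) ≤ Set.ncard Sout + Set.ncard Sin := by exact_mod_cast hcount
    have hsqrt0 : 0 ≤ Real.sqrt xr := Real.sqrt_nonneg _
    have hgoal : (Nat.primeCounting x : ℝ) ≤ 8 * (Set.ncard Sout : ℝ) := by
      linarith [hlowK, hup', e1, e2, hLi, hpi, hsize, hsqrt0]
    exact_mod_cast hgoal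

end Summit.QuantumAdvantage.QuantumAdvantage.Cruxes.DegreeOnePrimesEscape.OneSidedShadows

/-! ## §2 — idea `heilbronn-count-discharge` -/

namespace Summit.QuantumAdvantage.QuantumAdvantage.Cruxes.DegreeOnePrimesEscape.HeilbronnCount

open Literature.RepresentationTheory.FiniteGroups

/-- **Stark's no-quadratic-subfield non-vanishing with an INEXPLICIT constant** — all that the
crux needs (its `C = C(n)` is existential): for every `n` there is `c = c(n) > 0` such that for
every number field `K` of degree `n` without quadratic subfield, `ζ_K(σ) ≠ 0` for
`1 − c/log|d_K| ≤ σ < 1`.  The card's claim: this is PROVABLE from in-tree theorems (uniform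
simplicity of the near-`1` real zero of `ζ_N` for the Galois closure `N`,
`exists_realZero_simple_dedekindZeta₁`; Artin–Brauer meromorphy, induction invariance, rank-one
entireness, all `_holds`; complete character theory of finite groups) by Heilbronn's count. -/
def StarkNoQuadSubfieldInexplicit : Prop :=
  ∀ n : ℕ, ∃ c : ℝ, 0 < c ∧ ∀ (K : Type) [Field K] [NumberField K], Module.finrank ℚ K = n →
    (∀ F : IntermediateField ℚ K, Module.finrank ℚ F ≠ 2) →
    ∀ σ : ℝ, 1 - c / Real.log ((NumberField.discr K).natAbs : ℝ) ≤ σ → σ < 1 →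
      dedekindZetaCont K σ ≠ 0

/-- The explicit in-tree named fact implies the inexplicit one (`c = 1/(4·n!)`), so the line
loses nothing if the discharge stalls. -/
theorem starkNoQuadSubfieldInexplicit_of_named
    (h : Stark1974_dedekindZeta_ne_zero_of_noQuadraticSubfield) : StarkNoQuadSubfieldInexplicit := by
  intro n
  refine ⟨1 / (4 * (n.factorial : ℝ)), by positivity, fun K _ _ hK hnq σ hσ hσ1 => ?_⟩
  refine h K hnq σ ?_ hσ1
  subst hK
  have : 1 / (4 * ((Module.finrank ℚ K).factorial : ℝ)) / Real.log ((NumberField.discr K).natAbs : ℝ)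
      = 1 / (4 * ((Module.finrank ℚ K).factorial : ℝ) * Real.log ((NumberField.discr K).natAbs : ℝ)) := by
    rw [div_div]
  linarith [this]

/-- **Heilbronn's inequality, the lever's core (PROVED): a class function on a finite group whose
restriction to every cyclic subgroup is a genuine character is bounded by its value at `1`**
(`|tr ρ(h)| ≤ dim V` for `h` of finite order: the eigenvalues are roots of unity).  Applied to the
Heilbronn virtual character `θ_β = ∑_χ (ord_{s=β} L(s,χ,N/ℚ)) χ` of `G = Gal(N/ℚ)` (a genuine
character on each cyclic `⟨g⟩`, because there it is `∑_φ (ord_β L(s,φ,N/N^{⟨g⟩})) φ` with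
non-negative orders: abelian Artin `L`-functions are entire), it gives
`∑_χ n_χ² = ⟨θ_β, θ_β⟩ ≤ θ_β(1)² = (ord_β ζ_N)²`. [folklore] -/
theorem norm_apply_le_norm_apply_one {G : Type} [Group G] [Finite G] (θ : G → ℂ)
    (hθ : ∀ g : G, IsCharacter (Subgroup.zpowers g) (fun h : Subgroup.zpowers g => θ h)) (g : G) :
    ‖θ g‖ ≤ ‖θ 1‖ := by
  obtain ⟨V, _, _, _, ρ, hρ⟩ := hθ g
  have hg : θ g = ρ.character ⟨g, Subgroup.mem_zpowers g⟩ := by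
    have := congrFun hρ ⟨g, Subgroup.mem_zpowers g⟩
    simpa using this.symm
  have h1 : θ 1 = ρ.character 1 := by
    have := congrFun hρ 1
    simpa using this.symm
  rw [hg, h1, Representation.char_one, Complex.norm_natCast]
  -- `|tr ρ(h)| ≤ dim V` for an element of finite order: the eigenvalues are roots of unity.
  classical
  set g' : Subgroup.zpowers g := ⟨g, Subgroup.mem_zpowers g⟩ with hg'def
  haveI : Finite (Subgroup.zpowers g) := inferInstance
  obtain ⟨N, hNpos, hN⟩ : ∃ N : ℕ, 0 < N ∧ g' ^ N = 1 :=
    ⟨orderOf g', orderOf_pos g', pow_orderOf_eq_one g'⟩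
  have hρN : (ρ g') ^ N = 1 := by rw [← map_pow, hN, map_one]
  set b := Module.finBasis ℂ V with hbdef
  set A : Matrix (Fin (Module.finrank ℂ V)) (Fin (Module.finrank ℂ V)) ℂ :=
    LinearMap.toMatrix b b (ρ g') with hAdef
  have hchar : ρ.character g' = A.trace := by
    simp only [Representation.character, hAdef]
    exact LinearMap.trace_eq_matrix_trace ℂ b (ρ g')
  have hAN : A ^ N = 1 := by
    rw [hAdef, LinearMap.toMatrix_pow, hρN, LinearMap.toMatrix_one]
  have hroot : ∀ μ ∈ A.charpoly.roots, ‖μ‖ = 1 := by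
    intro μ hμ
    have hr : Polynomial.IsRoot A.charpoly μ :=
      (Polynomial.mem_roots (Matrix.charpoly_monic A).ne_zero).1 hμ
    have hsp : μ ∈ spectrum ℂ A := Matrix.mem_spectrum_iff_isRoot_charpoly.mpr hr
    rw [spectrum.mem_iff, Matrix.isUnit_iff_isUnit_det, isUnit_iff_ne_zero, not_not] at hsp
    obtain ⟨v, hv0, hv⟩ := Matrix.exists_mulVec_eq_zero_iff.mpr hsp
    have hAv : A.mulVec v = μ • v := by
      rw [Matrix.sub_mulVec, sub_eq_zero, Algebra.algebraMap_eq_smul_one, Matrix.smul_mulVec,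
        Matrix.one_mulVec] at hv
      exact hv.symm
    have hpow : ∀ k : ℕ, (A ^ k).mulVec v = μ ^ k • v := by
      intro k
      induction k with
      | zero => simp
      | succ k ih =>
        rw [pow_succ, ← Matrix.mulVec_mulVec, hAv, Matrix.mulVec_smul, ih, smul_smul, pow_succ']
    have hfix := hpow N
    rw [hAN, Matrix.one_mulVec] at hfix
    have hμN : μ ^ N = 1 := by
      by_contra hne
      apply hv0
      have h0 : (1 - μ ^ N) • v = 0 := by rw [sub_smul, one_smul, ← hfix, sub_self]
      exact (smul_eq_zero.mp h0).resolve_left (sub_ne_zero.mpr (Ne.symm hne))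
    exact Complex.norm_eq_one_of_pow_eq_one hμN hNpos.ne'
  rw [hchar, Matrix.trace_eq_sum_roots_charpoly]
  calc ‖A.charpoly.roots.sum‖ ≤ (A.charpoly.roots.map fun μ => ‖μ‖).sum := norm_multiset_sum_le _
    _ = (A.charpoly.roots.map fun _ => (1 : ℝ)).sum := by rw [Multiset.map_congr rfl hroot]
    _ = (A.charpoly.roots.card : ℝ) := by simp
    _ ≤ (A.charpoly.natDegree : ℝ) := by exact_mod_cast Polynomial.card_roots' _
    _ = (Module.finrank ℂ V : ℝ) := by rw [Matrix.charpoly_natDegree_eq_dim, Fintype.card_fin]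

/-- **F_low, PROVED from the in-tree Thorner–Zaman fact and the INEXPLICIT Stark non-vanishing**
(the card's depth 0 for K1): sum the class dichotomy over all classes; the `β₁`-terms cancel
unless `χ₁ = 1` (`sum_hom_units_eq_zero`); if `χ₁ = 1`, `β₁` is a real zero of
`ζ_K = L(s, 1)` (`classGroupLFunction_one`), Stark pushes it below `1 − c/log|d_K|`, so
`x^{β₁−1} ≤ e^{−c C₁} ≤ e^{−4}` for `x ≥ Q^{C₁}`, and `Li(x) − Li(x^{β₁}) ≥ (x − x^{β₁})/log x`
(tree) with `Li(x) ≤ (26/25) x/log x` (above) finishes. -/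
theorem lowerPITShadow_of_TZ_starkInexplicit (hTZ : ThornerZaman2019_classPNT_hilbertClassField)
    (hSt : StarkNoQuadSubfieldInexplicit) : OneSidedShadows.LowerPITShadow := by
  classical
  obtain ⟨c₁, c₂, c₃, hc₁, hc₂, hc₃, H⟩ := hTZ
  intro n hn
  obtain ⟨c, hc, hS⟩ := hSt n
  set L : ℝ := max 1 (Real.log (64 * c₃)) with hLdef
  refine ⟨max (max c₁ 44) (max (max (L / c₂) (L ^ 2 / (c₂ * Real.log 2))) (4 / c)), ?_⟩
  intro K _ _ hKn hnq x hx
  have hK : 1 < Module.finrank ℚ K := by rw [hKn]; exact hn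
  set C₁ : ℝ := max (max c₁ 44) (max (max (L / c₂) (L ^ 2 / (c₂ * Real.log 2))) (4 / c)) with hC₁def
  set Q : ℝ := ThornerZaman.condQn K with hQdef
  set h : ℕ := NumberField.classNumber K with hhdef
  -- basic sizes
  have hQ12 : 12 ≤ Q := ThornerZaman.twelve_le_condQn (K := K) hK
  have hQ1 : 1 ≤ Q := by linarith
  have hQpos : 0 < Q := by linarith
  have hC₁c₁ : c₁ ≤ C₁ := le_trans (le_max_left _ _) (le_max_left _ _)
  have hC₁44 : 44 ≤ C₁ := le_trans (le_max_right _ _) (le_max_left _ _)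
  have hC₁c : 4 / c ≤ C₁ := le_trans (le_max_right _ _) (le_max_right _ _)
  have hC₁0 : 0 ≤ C₁ := by linarith
  have hxc₁ : Q ^ c₁ ≤ x := le_trans (Real.rpow_le_rpow_of_exponent_le hQ1 hC₁c₁) hx
  have hxpos : 0 < x := lt_of_lt_of_le (Real.rpow_pos_of_pos hQpos _) hx
  have hlogx : C₁ * Real.log Q ≤ Real.log x := by
    have := Real.log_le_log (Real.rpow_pos_of_pos hQpos _) hx
    rwa [Real.log_rpow hQpos] at this
  have hlog2 : (0.6931471803 : ℝ) < Real.log 2 := Real.log_two_gt_d9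
  have hlogQ2 : 2 * Real.log 2 ≤ Real.log Q := by
    have h1 := OneSidedShadows.finrank_mul_log_two_le_log_condQn K hK
    have h2 : (2 : ℝ) ≤ Module.finrank ℚ K := by exact_mod_cast hK
    nlinarith
  have hlogQpos : 0 < Real.log Q := by linarith
  have hlogx60 : 60 ≤ Real.log x := by nlinarith
  have hx_exp : Real.exp 60 ≤ x := (Real.le_log_iff_exp_le hxpos).1 hlogx60
  have hx1 : 1 < x := by
    have : (1:ℝ) < Real.exp 60 := by have := Real.add_one_le_exp (60:ℝ); linarith
    linarith
  have hlogxpos : 0 < Real.log x := by linarith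
  have hE : c₃ * ThornerZaman.errorTermN c₂ Q (Module.finrank ℚ K) x ≤ 1 / 32 :=
    OneSidedShadows.errorTermN_le_of_ge hc₂ hc₃
      (le_trans (le_trans (le_max_left _ _) (le_max_left _ _)) (le_max_right _ _))
      (le_trans (le_trans (le_max_right _ _) (le_max_left _ _)) (le_max_right _ _)) K hK hx
  have hEpos : 0 < c₃ * ThornerZaman.errorTermN c₂ Q (Module.finrank ℚ K) x :=
    mul_pos hc₃ (ThornerZaman.errorTermN_pos _ _ _ _)
  have hLiup : offsetLogIntegral x ≤ 26 / 25 * (x / Real.log x) :=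
    OneSidedShadows.offsetLogIntegral_le_mul_div_log hx_exp
  have hxl : 0 ≤ x / Real.log x := by positivity
  -- per-class lower bound
  have key : ∀ (π m : ℝ), |π - m| ≤ c₃ * ThornerZaman.errorTermN c₂ Q (Module.finrank ℚ K) x * m →
      31 / 32 * m ≤ π := by
    intro π m hπ
    have hm : 0 ≤ m := by
      by_contra hneg
      rw [not_le] at hneg
      have : c₃ * ThornerZaman.errorTermN c₂ Q (Module.finrank ℚ K) x * m < 0 := mul_neg_of_pos_of_neg hEpos hneg
      linarith [abs_nonneg (π - m)]
    have h1 := (abs_sub_le_iff.1 hπ).2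
    nlinarith
  -- total count
  have htot : (primeIdealCount K x : ℝ) = ∑ C : ClassGroup (𝓞 K), (primeIdealClassCount K C x : ℝ) := by
    exact_mod_cast OneSidedShadows.primeIdealCount_eq_sum_classCount K x
  have hcardC : ((Finset.univ : Finset (ClassGroup (𝓞 K))).card : ℝ) = h := by
    rw [Finset.card_univ, hhdef, NumberField.classNumber]
  have hhpos : (0 : ℝ) < h := by exact_mod_cast NumberField.classNumber_pos (K := K)
  rcases H K hK with ⟨-, hA⟩ | ⟨χ₁, β₁, -, hβlo, hβhi, hzero, hB⟩
  · -- no exceptional zero: π_K ≥ (31/32) Li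
    have hC : ∀ C : ClassGroup (𝓞 K),
        31 / 32 * (offsetLogIntegral x / h) ≤ (primeIdealClassCount K C x : ℝ) :=
      fun C => key _ _ (hA C x hxc₁)
    have hπ : 31 / 32 * offsetLogIntegral x ≤ (primeIdealCount K x : ℝ) := by
      rw [htot]
      calc 31 / 32 * offsetLogIntegral x
          = ∑ C : ClassGroup (𝓞 K), 31 / 32 * (offsetLogIntegral x / h) := by
            rw [Finset.sum_const, nsmul_eq_mul, hcardC]; field_simp
        _ ≤ ∑ C : ClassGroup (𝓞 K), (primeIdealClassCount K C x : ℝ) :=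
            Finset.sum_le_sum fun C _ => hC C
    have hLix : 0 ≤ offsetLogIntegral x := by
      have h2 : (2:ℝ) ≤ x := by have := Real.add_one_le_exp (60:ℝ); linarith
      have := sub_mul_inv_log_pow_le_offsetLogIntegralPow 1 h2
      rw [offsetLogIntegralPow_one] at this
      have h0 : 0 ≤ (x - 2) * (Real.log x)⁻¹ ^ 1 := by
        apply mul_nonneg (by linarith); positivity
      linarith
    linarith only [hπ, hLix]
  · -- exceptional (χ₁, β₁)
    have hC : ∀ C : ClassGroup (𝓞 K), 31 / 32 *
        ((offsetLogIntegral x - ((χ₁ C : ℂ)).re * offsetLogIntegral (x ^ β₁)) / h)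
          ≤ (primeIdealClassCount K C x : ℝ) :=
      fun C => key _ _ (hB C x hxc₁)
    have hsumπ : 31 / 32 * ∑ C : ClassGroup (𝓞 K),
        (offsetLogIntegral x - ((χ₁ C : ℂ)).re * offsetLogIntegral (x ^ β₁)) / h
          ≤ (primeIdealCount K x : ℝ) := by
      rw [htot, Finset.mul_sum]
      exact Finset.sum_le_sum fun C _ => hC C
    have hsum : ∑ C : ClassGroup (𝓞 K),
        (offsetLogIntegral x - ((χ₁ C : ℂ)).re * offsetLogIntegral (x ^ β₁)) / (h : ℝ)
        = ((h : ℝ) * offsetLogIntegral x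
            - (∑ C : ClassGroup (𝓞 K), ((χ₁ C : ℂ)).re) * offsetLogIntegral (x ^ β₁)) / h := by
      rw [← Finset.sum_div, Finset.sum_sub_distrib, Finset.sum_const, nsmul_eq_mul, Finset.sum_mul,
        hcardC]
    -- Li(x) ≥ 0 and the two subcases
    have hx2 : (2:ℝ) ≤ x := by have := Real.add_one_le_exp (60:ℝ); linarith
    have hLix : 0 ≤ offsetLogIntegral x := by
      have := sub_mul_inv_log_pow_le_offsetLogIntegralPow 1 hx2
      rw [offsetLogIntegralPow_one] at this
      have h0 : 0 ≤ (x - 2) * (Real.log x)⁻¹ ^ 1 := by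
        apply mul_nonneg (by linarith); positivity
      linarith
    by_cases hχ1 : χ₁ = 1
    · -- χ₁ trivial: β₁ is a zero of ζ_K; Stark pushes it left
      subst hχ1
      have hre : ∑ C : ClassGroup (𝓞 K), (((1 : ClassGroup (𝓞 K) →* ℂˣ) C : ℂ)).re = h := by
        simp only [MonoidHom.one_apply, Units.val_one, Complex.one_re, Finset.sum_const,
          nsmul_eq_mul, mul_one]
        exact hcardC
      rw [hre] at hsum
      have hmain : ∑ C : ClassGroup (𝓞 K),
          (offsetLogIntegral x - (((1 : ClassGroup (𝓞 K) →* ℂˣ) C : ℂ)).re * offsetLogIntegral (x ^ β₁)) / (h : ℝ)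
          = offsetLogIntegral x - offsetLogIntegral (x ^ β₁) := by
        rw [hsum]; field_simp
      rw [hmain] at hsumπ
      -- Stark
      have hβ1c : (β₁ : ℂ) ≠ 1 := by
        intro heq
        have := congrArg Complex.re heq
        simp at this
        linarith
      have hzeta : dedekindZetaCont K β₁ = 0 := by
        rw [← classGroupLFunction_one K hβ1c]; exact hzero
      set d : ℝ := ((NumberField.discr K).natAbs : ℝ) with hddef
      have hd_eq : d = |(NumberField.discr K : ℝ)| := by
        rw [hddef, Nat.cast_natAbs, Int.cast_abs]
      have hd3 : (3 : ℝ) ≤ d := by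
        have h2 := NumberField.abs_discr_gt_two hK
        rw [hd_eq, ← Int.cast_abs]
        exact_mod_cast (show (3:ℤ) ≤ |NumberField.discr K| by omega)
      have hdpos : 0 < d := by linarith
      have hlogd : 0 < Real.log d := Real.log_pos (by linarith)
      have hdQ : d ≤ Q := by
        rw [hQdef, ThornerZaman.condQn, hd_eq]
        have hn1 : (1:ℝ) ≤ (Module.finrank ℚ K : ℝ) ^ Module.finrank ℚ K :=
          one_le_pow₀ (by exact_mod_cast hK.le)
        have h0 : 0 ≤ |(NumberField.discr K : ℝ)| := abs_nonneg _
        nlinarith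
      have hlogdQ : Real.log d ≤ Real.log Q := Real.log_le_log hdpos hdQ
      have hβup : β₁ < 1 - c / Real.log d := by
        by_contra hcon
        rw [not_lt] at hcon
        exact hS K hKn hnq β₁ hcon hβhi hzeta
      -- (1 − β₁) log x ≥ 4
      have hgap : 4 ≤ (1 - β₁) * Real.log x := by
        have h1 : c / Real.log d ≤ 1 - β₁ := by linarith only [hβup]
        have hcd : 0 ≤ c / Real.log d := div_nonneg hc.le hlogd.le
        have h2 : c / Real.log d * (C₁ * Real.log d) = c * C₁ := by
          field_simp
        have h3 : c / Real.log d * (C₁ * Real.log d) ≤ c / Real.log d * Real.log x := by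
          apply mul_le_mul_of_nonneg_left _ hcd
          have : C₁ * Real.log d ≤ C₁ * Real.log Q := mul_le_mul_of_nonneg_left hlogdQ hC₁0
          linarith only [this, hlogx]
        have h4 : 4 ≤ c * C₁ := by
          have := (div_le_iff₀ hc).1 hC₁c; linarith only [this]
        have h5 : c / Real.log d * Real.log x ≤ (1 - β₁) * Real.log x :=
          mul_le_mul_of_nonneg_right h1 hlogxpos.le
        linarith only [h2, h3, h4, h5]
      -- x^{β₁} ≤ x / 50
      have hβpos : 0 < β₁ := by
        have hlQ1 : 1 ≤ Real.log Q := by linarith only [hlogQ2, hlog2]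
        have : 1 / (8 * Real.log Q) ≤ 1 / 8 :=
          one_div_le_one_div_of_le (by norm_num) (by linarith only [hlQ1])
        linarith only [this, hβlo]
      have hxβ : x ^ β₁ ≤ x / 50 := by
        have h1 : x ^ β₁ = x ^ (β₁ - 1) * x := by
          rw [← Real.rpow_add_one hxpos.ne' (β₁ - 1)]; norm_num
        have h2 : x ^ (β₁ - 1) ≤ Real.exp (-4) := by
          rw [Real.rpow_def_of_pos hxpos]
          apply Real.exp_le_exp.2
          nlinarith only [hgap]
        have h3 : Real.exp (-4) ≤ 1 / 50 := by
          rw [Real.exp_neg]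
          have h50 : (50:ℝ) ≤ Real.exp 4 := by
            have e1 : Real.exp 4 = Real.exp 1 ^ 4 := by rw [← Real.exp_nat_mul]; norm_num
            have e2 : (2.7 : ℝ) ≤ Real.exp 1 := le_of_lt (lt_trans (by norm_num) Real.exp_one_gt_d9)
            rw [e1]
            calc (50:ℝ) ≤ 2.7 ^ 4 := by norm_num
              _ ≤ Real.exp 1 ^ 4 := pow_le_pow_left₀ (by norm_num) e2 4
          rw [inv_eq_one_div, div_le_div_iff₀ (Real.exp_pos 4) (by norm_num)]
          linarith
        rw [h1]
        have : x ^ (β₁ - 1) * x ≤ (1 / 50) * x := by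
          apply mul_le_mul_of_nonneg_right (le_trans h2 h3) hxpos.le
        linarith only [this]
      -- Li x − Li x^β ≥ (x − x^β)/log x ≥ (49/50) x / log x
      have hdiff : (x - x ^ β₁) / Real.log x ≤ offsetLogIntegral x - offsetLogIntegral (x ^ β₁) :=
        sub_rpow_div_log_le_offsetLogIntegral_sub hx1 hβpos hβhi.le
      have hdiff2 : 49 / 50 * (x / Real.log x) ≤ (x - x ^ β₁) / Real.log x := by
        rw [mul_div_assoc', div_le_div_iff_of_pos_right hlogxpos]
        linarith only [hxβ]
      -- assemble: 8 π_K ≥ 8 (31/32)(49/50)(x/log x) ≥ 7 (26/25)(x / log x) ≥ 7 Li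
      linarith only [hsumπ, hdiff, hdiff2, hLiup, hxl]
    · -- χ₁ nontrivial: the β₁-terms cancel
      have hψ : (Units.coeHom ℂ).comp χ₁ ≠ 1 := by
        intro heq
        apply hχ1
        ext C
        have := DFunLike.congr_fun heq C
        simpa using this
      have hre : ∑ C : ClassGroup (𝓞 K), ((χ₁ C : ℂ)).re = 0 := by
        have h0 := sum_hom_units_eq_zero ((Units.coeHom ℂ).comp χ₁) hψ
        rw [← Complex.re_sum]
        have : ∑ C : ClassGroup (𝓞 K), (χ₁ C : ℂ) = ∑ C : ClassGroup (𝓞 K), ((Units.coeHom ℂ).comp χ₁) C := by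
          apply Finset.sum_congr rfl; intro C _; rfl
        rw [this, h0, Complex.zero_re]
      rw [hre] at hsum
      have hmain : ∑ C : ClassGroup (𝓞 K),
          (offsetLogIntegral x - ((χ₁ C : ℂ)).re * offsetLogIntegral (x ^ β₁)) / (h : ℝ)
          = offsetLogIntegral x := by
        rw [hsum, zero_mul, sub_zero, mul_div_assoc, mul_div_cancel₀ _ hhpos.ne']
      rw [hmain] at hsumπ
      linarith only [hsumπ, hLix]

end Summit.QuantumAdvantage.QuantumAdvantage.Cruxes.DegreeOnePrimesEscape.HeilbronnCount

/-! ## §3 — assembly of the depth-0 landing pieces -/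

namespace Summit.QuantumAdvantage.QuantumAdvantage.Cruxes.DegreeOnePrimesEscape.OneSidedShadows

/-- F_low from the two NAMED facts in the tree (Thorner–Zaman + Stark explicit), through the
inexplicit form (PROVED). -/
theorem lowerPITShadow_of_TZ_Stark (hTZ : ThornerZaman2019_classPNT_hilbertClassField)
    (hSt : Stark1974_dedekindZeta_ne_zero_of_noQuadraticSubfield) : LowerPITShadow :=
  HeilbronnCount.lowerPITShadow_of_TZ_starkInexplicit hTZ
    (HeilbronnCount.starkNoQuadSubfieldInexplicit_of_named hSt)

/-- **THE CRUX, conditionally on the two in-tree named facts** (depth 0 of card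
`one-sided-shadows`, complete): `DegreeOnePrimesEscape` from Thorner–Zaman 2019 Thm 1.4 for the
Hilbert class field and Stark's no-quadratic-subfield non-vanishing.  Sorry-free; axioms
`propext`, `Classical.choice`, `Quot.sound` only. -/
theorem degreeOnePrimesEscape_of_TZ_Stark (hTZ : ThornerZaman2019_classPNT_hilbertClassField)
    (hSt : Stark1974_dedekindZeta_ne_zero_of_noQuadraticSubfield) :
    Summit.QuantumAdvantage.QuantumAdvantage.Theses.LinnikCubicClassGroups.DegreeOnePrimesEscape :=
  degreeOnePrimesEscape_of_shadows (subgroupUpperShadow_of_TZ hTZ) (lowerPITShadow_of_TZ_Stark hTZ hSt)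

/-- **THE CRUX from Thorner–Zaman alone plus the INEXPLICIT Stark non-vanishing** (the target of
card `heilbronn-count-discharge`, which proposes to PROVE the second hypothesis from the tree's
Artin formalism). -/
theorem degreeOnePrimesEscape_of_TZ_starkInexplicit
    (hTZ : ThornerZaman2019_classPNT_hilbertClassField)
    (hSt : HeilbronnCount.StarkNoQuadSubfieldInexplicit) :
    Summit.QuantumAdvantage.QuantumAdvantage.Theses.LinnikCubicClassGroups.DegreeOnePrimesEscape :=
  degreeOnePrimesEscape_of_shadows (subgroupUpperShadow_of_TZ hTZ)
    (HeilbronnCount.lowerPITShadow_of_TZ_starkInexplicit hTZ hSt)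

end Summit.QuantumAdvantage.QuantumAdvantage.Cruxes.DegreeOnePrimesEscape.OneSidedShadows

end
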